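import Mathlib
import Summits.Ventures.HodgeRepro.Tier4.Line1.IsotypicBernsteinCore
import Summits.Ventures.HodgeRepro.Tier4.Line1.IsotypicC2

/-!
# Tier4/Line1/IsotypicBernstein — BERNSTEIN ON THE ALGEBRAIC CORES: an `H`-linear isomorphism of fixed blocks
`W i ≃ₗ[H] W j` extends to an isomorphism of representations between the invariant subspaces they generate;
hence (C2) `hnon` follows from MULTIPLICITY ONE of the cores alone

Blind re-derivation cell `pub-hodge-repro`, Tier 4 (README §9–§10), seat t4-L1-p2 (gen 4), LINE L1; the closing
module of the cut (C2-BERNSTEIN) (S14153).  Target tree path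
`lean/Summits/Ventures/HodgeRepro/Tier4/Line1/IsotypicBernstein.lean`.  Imports this seat's `IsotypicBernsteinCore`
(`sum_R_map_eq_zero`, `R_smul_left`, `IsTest.smul`; the kill lemma lives there too) — through it `GeneratedSubspace`
(`generated`, `isInvariantSubspace_generated`, `generated_subset`, `R_mem_generated`, `R_R_eq_R_conv`,
`R_rightTranslate`, `IsTest.leftTranslate`, `R_add'`, `R_smul'`, `R_zero'`), t4-L1-p4's `RelClosed`
(`continuous_R_of_invariant`), p2 g0's `ConvTest` (`conv_isTest`) — and `IsotypicC2` (`IsIntertwiner`, `IsIsoRep`,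
`IsoRep`).  0 print.

WHAT IS PROVED.  `core W := generated (span ↑W)` is the ALGEBRAIC CORE of a constituent over its fixed block `W`
(the span of the `R(f) w`, `f` a test function, `w ∈ W`; an invariant subspace, `L²(DG)`-dense in the constituent
by irreducibility).  For `θ : W i →ₗ[H] W j` the map `bern θ` sends `∑ R(f_k) w_k ↦ ∑ R(f_k) (θ w_k)`: it is
well defined by `sum_R_map_eq_zero` (the kernel of the generator map `coreL` is contained in that of `coreL' θ`, so
`coreL' θ` factors through `range coreL = core W i` by `Submodule.liftQ` and `LinearMap.quotKerEquivRange`), it is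
an INTERTWINER `core W i → core W j` (`isIntertwiner_bern`: linear, commuting with right translation by
`R_rightTranslate` and with every `R(f)` by the composition law, checked on the generators and extended by
`Submodule.span_induction`), and for an isomorphism `θ` the maps `bern θ`, `bern θ.symm` are mutually inverse
(`isIsoRep_bern`).  THEOREM `isoRep_core_of_linearEquiv : W i ≃ₗ[H] W j → IsoRep (core W i) (core W j)` and the
(C2) corollary `hnon_of_multiplicityOne_core`: if the cores of distinct constituents of the block are NOT isomorphic
representations (multiplicity one, DISPLAYED), the fixed blocks are pairwise non-isomorphic `H`-modules — the field
`hnon` of p5's `IdempotentData` / `HeckeBlockW`.  Displayed: `hfull` («`H ⊇ e ⋆ C_c(G) ⋆ e`», definitional for the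
full spherical Hecke algebra by `R_R_eq_R_conv_conv`), irreducibility of the constituents (p1's `IsAdaptedONB`
field), and multiplicity one of the cores; nothing printed.

NOT claimed: an isomorphism of the constituents `V i ≅ V j` themselves (the extension of `bern θ` from the core to
its `L²(DG)`-closure inside the continuous functions is not available in the tree's model).  Nothing here says
anything about the status of the Hodge conjecture for CM abelian varieties, which is NOT proved (HC_CM is NOT proved
by anyone in this repository).
-/

set_option autoImplicit false

noncomputable section

namespace Summit.Ventures.HodgeRepro.Tier4.Line1

open MeasureTheory Topology

namespace RTF

namespace Setting

variable {G : Type} [Group G] [TopologicalSpace G] [IsTopologicalGroup G] [MeasurableSpace G] [BorelSpace G]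
  (S : Setting G)

section Core

variable {H : Type} [Ring H] {Vb : Submodule ℂ (G → ℂ)} [Module H Vb]

/-- the `ℂ`-span of a fixed block, as a space of functions. -/
def blockSpan (W : Submodule H Vb) : Submodule ℂ (G → ℂ) := Submodule.span ℂ (Subtype.val '' (W : Set Vb))

omit [Group G] [TopologicalSpace G] [IsTopologicalGroup G] [MeasurableSpace G] [BorelSpace G] in
/-- a block vector lies in the span. -/
theorem mem_blockSpan {W : Submodule H Vb} (w : W) : ((w : Vb) : G → ℂ) ∈ blockSpan W :=
  Submodule.subset_span ⟨(w : Vb), w.2, rfl⟩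

omit [Group G] [TopologicalSpace G] [IsTopologicalGroup G] [MeasurableSpace G] [BorelSpace G] in
/-- the span of a block lies in `Vb`. -/
theorem blockSpan_le (W : Submodule H Vb) : blockSpan W ≤ Vb := by
  refine Submodule.span_le.2 ?_
  rintro _ ⟨v, -, rfl⟩
  exact v.2

/-- **the algebraic core** of a constituent over its fixed block `W`: the invariant subspace generated by the block. -/
def core (W : Submodule H Vb) : Submodule ℂ (G → ℂ) := S.generated (blockSpan W)

/-- the generators of the core, indexed by a test function and a block vector. -/
def CoreIdx (W : Submodule H Vb) : Type := {p : (G → ℂ) × W // IsTest p.1}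

/-- the generator `R(f) w`. -/
def coreGen (W : Submodule H Vb) (p : CoreIdx W) : G → ℂ := S.R p.1.1 ((p.1.2 : Vb) : G → ℂ)

/-- the generator map `(CoreIdx W →₀ ℂ) → (G → ℂ)`, `c ↦ ∑ c p • R(f_p) w_p`. -/
def coreL (W : Submodule H Vb) : (CoreIdx W →₀ ℂ) →ₗ[ℂ] (G → ℂ) := Finsupp.linearCombination ℂ (S.coreGen W)

variable {e : G → ℂ} (hVb : ∀ ψ : G → ℂ, ψ ∈ Vb ↔ S.Invariant ψ ∧ Continuous ψ ∧ S.R e ψ = ψ)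

omit [IsTopologicalGroup G] [BorelSpace G] in
include hVb in
/-- elements of the span of a block are continuous. -/
theorem continuous_of_mem_blockSpan {W : Submodule H Vb} {u : G → ℂ} (hu : u ∈ blockSpan W) : Continuous u :=
  ((hVb u).1 (blockSpan_le W hu)).2.1

include hVb in
/-- **the range of the generator map is the core**. -/
theorem range_coreL (W : Submodule H Vb) : LinearMap.range (S.coreL W) = S.core W := by
  rw [coreL, Finsupp.range_linearCombination, core, generated]
  refine le_antisymm (Submodule.span_le.2 ?_) (Submodule.span_le.2 ?_)
  · rintro _ ⟨p, rfl⟩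
    exact S.R_mem_generated p.2 (mem_blockSpan p.1.2)
  · rintro _ ⟨f, hf, n, hn, rfl⟩
    refine Submodule.span_induction (p := fun n _ => S.R f n ∈ Submodule.span ℂ (Set.range (S.coreGen W)))
      ?_ ?_ ?_ ?_ hn
    · rintro _ ⟨v, hv, rfl⟩
      exact Submodule.subset_span ⟨⟨(f, ⟨v, hv⟩), hf⟩, rfl⟩
    · rw [S.R_zero']
      exact Submodule.zero_mem _
    · intro x y hx hy hx' hy'
      rw [S.R_add' hf (S.continuous_of_mem_blockSpan hVb hx) (S.continuous_of_mem_blockSpan hVb hy)]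
      exact Submodule.add_mem _ hx' hy'
    · intro c x _ hx'
      rw [S.R_smul']
      exact Submodule.smul_mem _ c hx'

omit [IsTopologicalGroup G] [BorelSpace G] in
/-- the generators lie in the core. -/
theorem R_mem_core {W : Submodule H Vb} {f : G → ℂ} (hf : IsTest f) (w : W) :
    S.R f ((w : Vb) : G → ℂ) ∈ S.core W :=
  S.R_mem_generated hf (mem_blockSpan w)

variable {V : Set (G → ℂ)} (hinv : S.IsInvariantSubspace V) {W : Submodule H Vb}
  (hW : ∀ ψ : Vb, ψ ∈ W ↔ (ψ : G → ℂ) ∈ V)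

omit [IsTopologicalGroup G] [BorelSpace G] in
include hinv hW in
/-- the span of the block lies in the constituent. -/
theorem blockSpan_subset : (blockSpan W : Set (G → ℂ)) ⊆ V := by
  intro u hu
  refine Submodule.span_induction (p := fun u _ => u ∈ V) ?_ ?_ ?_ ?_ hu
  · rintro _ ⟨v, hv, rfl⟩
    exact (hW v).1 hv
  · exact IsInvariantSubspace.zero_mem_of_nonempty S hinv ⟨_, (hW 0).1 W.zero_mem⟩
  · intro x y _ _ hx hy
    exact hinv.add x hx y hy
  · intro c x _ hx
    exact hinv.smul x hx c

omit [IsTopologicalGroup G] [BorelSpace G] in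
include hinv hW in
/-- the core lies in the constituent. -/
theorem core_subset : (S.core W : Set (G → ℂ)) ⊆ V :=
  S.generated_subset hinv (S.blockSpan_subset hinv hW)

include hinv hW in
/-- the core is an invariant subspace. -/
theorem isInvariantSubspace_core [SecondCountableTopology G] [T2Space G] [MeasurableMul G] [SFinite S.μ] :
    S.IsInvariantSubspace (S.core W) :=
  S.isInvariantSubspace_generated hinv (S.blockSpan_subset hinv hW)

end Core

section Bern

variable {H : Type} [Ring H] {Vb : Submodule ℂ (G → ℂ)} [Module H Vb] {e : G → ℂ} {tst : H → G → ℂ}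
  (he : IsTest e) (hVb : ∀ ψ : G → ℂ, ψ ∈ Vb ↔ S.Invariant ψ ∧ Continuous ψ ∧ S.R e ψ = ψ)
  (hact : ∀ (r : H) (ψ : Vb), ((r • ψ : Vb) : G → ℂ) = S.R (tst r) ψ)
  (hfull : ∀ f : G → ℂ, IsTest f → ∃ r : H, ∀ ψ ∈ Vb, S.R e (S.R f ψ) = S.R (tst r) ψ)
  {Vi Vj : Set (G → ℂ)} (hinvi : S.IsInvariantSubspace Vi) (hinvj : S.IsInvariantSubspace Vj)
  (hirrj : S.IsIrreducible Vj) {Wi Wj : Submodule H Vb} (hWi : ∀ ψ : Vb, ψ ∈ Wi ↔ (ψ : G → ℂ) ∈ Vi)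
  (hWj : ∀ ψ : Vb, ψ ∈ Wj ↔ (ψ : G → ℂ) ∈ Vj)

/-- the transported generator `R(f) (θ w)`. -/
def coreGen' (θ : Wi →ₗ[H] Wj) (p : CoreIdx Wi) : G → ℂ := S.R p.1.1 ((θ p.1.2 : Vb) : G → ℂ)

/-- the transported generator map. -/
def coreL' (θ : Wi →ₗ[H] Wj) : (CoreIdx Wi →₀ ℂ) →ₗ[ℂ] (G → ℂ) := Finsupp.linearCombination ℂ (S.coreGen' θ)

include he hVb hact hfull hinvj hirrj hWj in
/-- **well-definedness**: the kernel of the generator map is contained in the kernel of the transported one. -/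
theorem ker_coreL_le [SecondCountableTopology G] [T2Space G] [MeasurableMul G] [SFinite S.μ]
    [LocallyCompactSpace G] (θ : Wi →ₗ[H] Wj) : LinearMap.ker (S.coreL Wi) ≤ LinearMap.ker (S.coreL' θ) := by
  intro c hc
  rw [LinearMap.mem_ker, coreL, Finsupp.linearCombination_apply, Finsupp.sum] at hc
  rw [LinearMap.mem_ker, coreL', Finsupp.linearCombination_apply, Finsupp.sum]
  have h0 : ∑ p ∈ c.support, S.R (c p • p.1.1) ((p.1.2 : Vb) : G → ℂ) = 0 := by
    rw [← hc]
    exact Finset.sum_congr rfl fun p _ => S.R_smul_left _ _ _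
  have h1 := S.sum_R_map_eq_zero he hVb hact hfull hinvj hirrj hWj θ c.support (fun p => c p • p.1.1)
    (fun p => p.2.smul (c p)) (fun p => p.1.2) h0
  rw [← h1]
  exact Finset.sum_congr rfl fun p _ => (S.R_smul_left _ _ _).symm

include he hVb hact hfull hinvj hirrj hWj in
/-- the transported generator map, factored through the core (`range coreL`). -/
def bern₀ [SecondCountableTopology G] [T2Space G] [MeasurableMul G] [SFinite S.μ] [LocallyCompactSpace G]
    (θ : Wi →ₗ[H] Wj) : LinearMap.range (S.coreL Wi) →ₗ[ℂ] (G → ℂ) :=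
  ((LinearMap.ker (S.coreL Wi)).liftQ (S.coreL' θ) (S.ker_coreL_le he hVb hact hfull hinvj hirrj hWj θ)) ∘ₗ
    (S.coreL Wi).quotKerEquivRange.symm.toLinearMap

include he hVb hact hfull hinvj hirrj hWj in
/-- `bern₀` on the class of `coreL c` is `coreL' θ c`. -/
theorem bern₀_coreL [SecondCountableTopology G] [T2Space G] [MeasurableMul G] [SFinite S.μ] [LocallyCompactSpace G]
    (θ : Wi →ₗ[H] Wj) (c : CoreIdx Wi →₀ ℂ) :
    S.bern₀ he hVb hact hfull hinvj hirrj hWj θ ⟨S.coreL Wi c, LinearMap.mem_range_self _ c⟩ = S.coreL' θ c := by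
  unfold bern₀
  rw [LinearMap.comp_apply]
  have h : (S.coreL Wi).quotKerEquivRange.symm.toLinearMap ⟨S.coreL Wi c, LinearMap.mem_range_self _ c⟩ =
      Submodule.Quotient.mk c := by
    rw [LinearEquiv.coe_toLinearMap, LinearEquiv.symm_apply_eq]
    exact Subtype.ext (LinearMap.quotKerEquivRange_apply_mk _ _).symm
  rw [h, Submodule.liftQ_apply]

/-- **the Bernstein map** `∑ R(f_k) w_k ↦ ∑ R(f_k) (θ w_k)` on the core, `0` elsewhere. -/
def bern [SecondCountableTopology G] [T2Space G] [MeasurableMul G] [SFinite S.μ] [LocallyCompactSpace G]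
    (θ : Wi →ₗ[H] Wj) (ψ : G → ℂ) : G → ℂ :=
  open Classical in
  if h : ψ ∈ LinearMap.range (S.coreL Wi) then S.bern₀ he hVb hact hfull hinvj hirrj hWj θ ⟨ψ, h⟩ else 0

variable [SecondCountableTopology G] [T2Space G] [MeasurableMul G] [SFinite S.μ] [LocallyCompactSpace G]

include he hVb hact hfull hinvj hirrj hWj in
/-- `bern` on the core is `bern₀`. -/
theorem bern_of_mem (θ : Wi →ₗ[H] Wj) {ψ : G → ℂ} (h : ψ ∈ LinearMap.range (S.coreL Wi)) :
    S.bern he hVb hact hfull hinvj hirrj hWj θ ψ = S.bern₀ he hVb hact hfull hinvj hirrj hWj θ ⟨ψ, h⟩ := by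
  unfold bern
  rw [dif_pos h]

include he hVb hact hfull hinvj hirrj hWj in
/-- `bern (coreL c) = coreL' θ c`. -/
theorem bern_coreL (θ : Wi →ₗ[H] Wj) (c : CoreIdx Wi →₀ ℂ) :
    S.bern he hVb hact hfull hinvj hirrj hWj θ (S.coreL Wi c) = S.coreL' θ c := by
  rw [S.bern_of_mem he hVb hact hfull hinvj hirrj hWj θ (LinearMap.mem_range_self _ c),
    S.bern₀_coreL he hVb hact hfull hinvj hirrj hWj θ c]

include he hVb hact hfull hinvj hirrj hWj in
/-- **on the generators**: `bern θ (R(f) w) = R(f) (θ w)`. -/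
theorem bern_R (θ : Wi →ₗ[H] Wj) {f : G → ℂ} (hf : IsTest f) (w : Wi) :
    S.bern he hVb hact hfull hinvj hirrj hWj θ (S.R f ((w : Vb) : G → ℂ)) = S.R f ((θ w : Vb) : G → ℂ) := by
  have h1 : S.R f ((w : Vb) : G → ℂ) = S.coreL Wi (Finsupp.single ⟨(f, w), hf⟩ 1) := by
    rw [coreL, Finsupp.linearCombination_single, one_smul]
    rfl
  rw [h1, S.bern_coreL he hVb hact hfull hinvj hirrj hWj θ, coreL', Finsupp.linearCombination_single, one_smul]
  rfl

include he hVb hact hfull hinvj hirrj hWj in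
/-- `bern` is additive on the core. -/
theorem bern_add (θ : Wi →ₗ[H] Wj) {ψ ψ' : G → ℂ} (h : ψ ∈ LinearMap.range (S.coreL Wi))
    (h' : ψ' ∈ LinearMap.range (S.coreL Wi)) :
    S.bern he hVb hact hfull hinvj hirrj hWj θ (ψ + ψ') =
      S.bern he hVb hact hfull hinvj hirrj hWj θ ψ + S.bern he hVb hact hfull hinvj hirrj hWj θ ψ' := by
  rw [S.bern_of_mem he hVb hact hfull hinvj hirrj hWj θ (add_mem h h'),
    S.bern_of_mem he hVb hact hfull hinvj hirrj hWj θ h, S.bern_of_mem he hVb hact hfull hinvj hirrj hWj θ h',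
    ← map_add]
  rfl

include he hVb hact hfull hinvj hirrj hWj in
/-- `bern` is homogeneous on the core. -/
theorem bern_smul (θ : Wi →ₗ[H] Wj) {ψ : G → ℂ} (h : ψ ∈ LinearMap.range (S.coreL Wi)) (a : ℂ) :
    S.bern he hVb hact hfull hinvj hirrj hWj θ (a • ψ) = a • S.bern he hVb hact hfull hinvj hirrj hWj θ ψ := by
  rw [S.bern_of_mem he hVb hact hfull hinvj hirrj hWj θ (Submodule.smul_mem _ a h),
    S.bern_of_mem he hVb hact hfull hinvj hirrj hWj θ h, ← map_smul]
  rfl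

include he hVb hact hfull hinvj hirrj hWj in
/-- `bern 0 = 0`. -/
theorem bern_zero (θ : Wi →ₗ[H] Wj) : S.bern he hVb hact hfull hinvj hirrj hWj θ 0 = 0 := by
  rw [S.bern_of_mem he hVb hact hfull hinvj hirrj hWj θ (Submodule.zero_mem _)]
  have : (⟨(0 : G → ℂ), Submodule.zero_mem _⟩ : LinearMap.range (S.coreL Wi)) = 0 := rfl
  rw [this, map_zero]

include he hVb hact hfull hinvj hirrj hWj in
/-- `bern` maps the core of `W i` into the core of `W j`. -/
theorem bern_mem_core (θ : Wi →ₗ[H] Wj) {ψ : G → ℂ} (h : ψ ∈ LinearMap.range (S.coreL Wi)) :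
    S.bern he hVb hact hfull hinvj hirrj hWj θ ψ ∈ S.core Wj := by
  obtain ⟨c, rfl⟩ := LinearMap.mem_range.1 h
  rw [S.bern_coreL he hVb hact hfull hinvj hirrj hWj θ c, coreL', Finsupp.linearCombination_apply, Finsupp.sum]
  refine Submodule.sum_mem _ fun p _ => Submodule.smul_mem _ _ ?_
  exact S.R_mem_core p.2 (θ p.1.2)

end Bern

end Setting

end RTF

end Summit.Ventures.HodgeRepro.Tier4.Line1

end
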